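import Summits.CriticalPhenomena.PercolationContinuityZ3.Theorems.PercNearOneGluingNoHeavyLowerTailSahiCTCRtThreeWindowReduction
import HarnessLib

/-!
# `NoHeavyLowerTail` (crux stmt-CriticalPhenomena-4575), P3 lane: THE SMALL PAIRS OF THE SQUAREFREE ROW LOCALISED ON THE 4-SETS, AND ROW 0
# REDUCED TO A LOCAL INEQUALITY ON EVERY 4-SUBSET

Support file (seat `prim-l12-p3`, gen 50; `--supports stmt-CriticalPhenomena-4575`).  Memo
`run/shared/lean/prim/prim-l12/FROM-prim-l12-p3-g50-KLEITMAN-BULK.md` §6.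

`…WindowReduction` wrote `[s^V] R_3 = (bulk ≥ 0) + Σ_{Q ⊆ V, #Q = 4} (local atom sum on Q) + SP(V)` with the small-pair term
`SP(V) = Σ_{S ⊆ V} (#crossing − #nested small pairs partitioning V∖S)` still global.  A small pair `(P, P')` (`#P, #P' ≤ 2`, disjoint) has at most four points,
so it too lives on the 4-sets: here
* `sum_pairsAt_eq_sum_ind` : `SP`-type sums as double indicator sums over all pairs of subsets of `V` (from `sum_pairsAt_eq_sum_sum`);
* `sum_two_eq` : the exchange `Σ_{Q ∈ 𝒬} Σ_{P,P' ⊆ Q} f = Σ_{P,P' ⊆ V} #{Q ∈ 𝒬 : P ∪ P' ⊆ Q}·f`;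
* `sum_pairsAt_eq_sum_powersetCard` : for families `A, B` of sets of size `≤ 2`,
  `Σ_{S ⊆ V} pairsAt A B (V∖S) = Σ_{Q ⊆ V, #Q=4} Σ_{P,P' ⊆ Q} [P ∈ A][P' ∈ B][P ∩ P' = ∅] / C(#V − #(P∪P'), 4 − #(P∪P'))` (`#V ≥ 4`);
* `coeff_ind_Rt_three_nonneg_of_local` : **ROW 0 for a pair of up-sets on `V` (`#V ≥ 4`) follows from the nonnegativity, for every 4-subset `Q` of `V`, of the
  LOCAL quantity** `atomSum(window tables / C) on Q + Σ_{P,P' ⊆ Q} ([P ∈ X₂ᵒ][P' ∈ Z₂ᵒ] − [P ∈ N₂][P' ∈ Y₂])·[P ∩ P' = ∅] / C(#V−#(P∪P'), 4−#(P∪P'))` — a statement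
  about the traces of the pair on `Q` with coefficients in `ℚ(#V)`; the 23-atom window family of the memo (§2.2) is such a local certificate for `#V ≥ 10`.
No new definitions; nothing is asserted about the crux.
-/

noncomputable section

open scoped Classical

namespace Summit.CriticalPhenomena.PercolationContinuityZ3.Theorems.SahiCTCForms

open Finset MvPolynomial SahiCTCGenFun

variable {α : Type*} [DecidableEq α]

/-- `Σ_{S ⊆ V} pairsAt A B (V∖S) = Σ_{P,P' ⊆ V} [P ∈ A][P' ∈ B][P ∩ P' = ∅]` (in `ℚ`). [this work] -/
theorem sum_pairsAt_eq_sum_ind (A B : Finset (Finset α)) (V : Finset α) :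
    ∑ S ∈ V.powerset, ((pairsAt A B (V \ S) : ℕ) : ℚ) =
      ∑ P ∈ V.powerset, ∑ P' ∈ V.powerset, ιq A P * ιq B P' * (if Disjoint P P' then 1 else 0) := by
  have h := sum_pairsAt_eq_sum_sum A B V (fun _ => True)
  rw [filter_true_of_mem (fun _ _ => trivial)] at h
  have h' : ((∑ S ∈ V.powerset, (pairsAt A B (V \ S) : ℤ) : ℤ) : ℚ) =
      ((∑ S ∈ V.powerset, ∑ S' ∈ V.powerset, ι A S * ι B S' * (if Disjoint S S' ∧ True then 1 else 0) : ℤ) : ℚ) := by rw [h]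
  push_cast at h'
  rw [h']
  refine sum_congr rfl fun P _ => sum_congr rfl fun P' _ => ?_
  rw [ι_cast, ι_cast]
  simp only [and_true]

/-- Exchange of two sums: `Σ_{Q ∈ 𝒬} Σ_{P ⊆ Q} Σ_{P' ⊆ Q} f = Σ_{P ⊆ V} Σ_{P' ⊆ V} #{Q ∈ 𝒬 : P ∪ P' ⊆ Q}·f` for `𝒬 ⊆ 2^V`. [this work] -/
theorem sum_two_eq (𝒬 : Finset (Finset α)) (V : Finset α) (h𝒬 : ∀ Q ∈ 𝒬, Q ⊆ V) (f : Finset α → Finset α → ℚ) :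
    ∑ Q ∈ 𝒬, ∑ P ∈ Q.powerset, ∑ P' ∈ Q.powerset, f P P' =
      ∑ P ∈ V.powerset, ∑ P' ∈ V.powerset, (#(𝒬.filter fun Q => P ∪ P' ⊆ Q) : ℚ) * f P P' := by
  have hstep : ∀ Q ∈ 𝒬, ∑ P ∈ Q.powerset, ∑ P' ∈ Q.powerset, f P P' =
      ∑ P ∈ V.powerset, ∑ P' ∈ V.powerset, (if P ∪ P' ⊆ Q then f P P' else 0) := by
    intro Q hQ
    have hQV := h𝒬 Q hQ
    rw [← sum_subset (powerset_mono.2 hQV) (fun P hP hPQ => ?_)]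
    · refine sum_congr rfl fun P hP => ?_
      have hPQ : P ⊆ Q := mem_powerset.1 hP
      rw [← sum_subset (powerset_mono.2 hQV) (fun P' hP' hP'Q => ?_)]
      · refine sum_congr rfl fun P' hP' => ?_
        rw [if_pos (union_subset hPQ (mem_powerset.1 hP'))]
      · rw [if_neg fun h => hP'Q (mem_powerset.2 (subset_union_right.trans h))]
    · refine sum_eq_zero fun P' _ => ?_
      rw [if_neg fun h => hPQ (mem_powerset.2 (subset_union_left.trans h))]
  rw [sum_congr rfl hstep, sum_comm]
  refine sum_congr rfl fun P _ => ?_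
  rw [sum_comm]
  refine sum_congr rfl fun P' _ => ?_
  rw [← sum_filter, sum_const, nsmul_eq_mul]

/-- **Small pairs on the 4-sets**: if every member of `A` and of `B` has at most two points, then for `#V ≥ 4`
`Σ_{S ⊆ V} pairsAt A B (V∖S) = Σ_{Q ⊆ V, #Q = 4} Σ_{P,P' ⊆ Q} [P ∈ A][P' ∈ B][P ∩ P' = ∅] / C(#V − #(P ∪ P'), 4 − #(P ∪ P'))`. [this work] -/
theorem sum_pairsAt_eq_sum_powersetCard (A B : Finset (Finset α)) (hA : ∀ P ∈ A, #P ≤ 2) (hB : ∀ P ∈ B, #P ≤ 2) (V : Finset α)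
    (hV : 4 ≤ #V) :
    ∑ S ∈ V.powerset, ((pairsAt A B (V \ S) : ℕ) : ℚ) =
      ∑ Q ∈ V.powersetCard 4, ∑ P ∈ Q.powerset, ∑ P' ∈ Q.powerset,
        ιq A P * ιq B P' * (if Disjoint P P' then 1 else 0) / (((#V - #(P ∪ P')).choose (4 - #(P ∪ P')) : ℕ) : ℚ) := by
  rw [sum_pairsAt_eq_sum_ind, sum_two_eq (V.powersetCard 4) V (fun Q hQ => (mem_powersetCard.1 hQ).1)]
  refine sum_congr rfl fun P hP => sum_congr rfl fun P' hP' => ?_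
  have hsub : P ∪ P' ⊆ V := union_subset (mem_powerset.1 hP) (mem_powerset.1 hP')
  rw [card_filter_powersetCard_superset V _ hsub 4]
  by_cases hPA : P ∈ A
  · by_cases hPB : P' ∈ B
    · have h4 : #(P ∪ P') ≤ 4 := (card_union_le P P').trans (by have := hA P hPA; have := hB P' hPB; omega)
      rw [if_pos h4]
      have hpos : 0 < (#V - #(P ∪ P')).choose (4 - #(P ∪ P')) := Nat.choose_pos (by omega)
      have hne : ((((#V - #(P ∪ P')).choose (4 - #(P ∪ P')) : ℕ) : ℚ)) ≠ 0 := by positivity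
      field_simp
    · simp [ιq, hPB]
  · simp [ιq, hPA]

/-- Members of the four small classes have at most two points. [this work] -/
theorem card_le_two_of_mem_small [Fintype α] (F G : Finset (Finset α)) :
    (∀ P ∈ smallXo F G, #P ≤ 2) ∧ (∀ P ∈ smallZo F G, #P ≤ 2) ∧ (∀ P ∈ smallN F G, #P ≤ 2) ∧ (∀ P ∈ smallY F G, #P ≤ 2) := by
  refine ⟨fun P hP => ?_, fun P hP => ?_, fun P hP => ?_, fun P hP => ?_⟩ <;>
  · simp only [smallXo, smallZo, smallN, smallY, bySize, mem_filter, mem_powerset] at hP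
    omega

/-- **ROW 0 FROM A LOCAL INEQUALITY ON EVERY 4-SET**: for a pair of up-sets on `V` (`#V ≥ 4`), if on every 4-subset `Q` of `V` the localised window atom
sum plus the localised small pairs is `≥ 0`, then `[s^V] R_3(𝒳,𝒵) ≥ 0`. [this work] -/
theorem coeff_ind_Rt_three_nonneg_of_local [Fintype α] {F G : Finset (Finset α)} (hF : IsUpperSet (F : Set (Finset α)))
    (hG : IsUpperSet (G : Set (Finset α))) (V : Finset α) (hV : 4 ≤ #V)
    (hloc : ∀ Q ∈ V.powersetCard 4, 0 ≤ atomSum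
          (fun a b c => (if 5 ≤ a + b + c then 0 else ∑ t ∈ range 3, (((#V - a - b - c).choose t : ℕ) : ℚ) *
            (if b + c < #V - t then ((((#V - t : ℕ) : ℚ)) * ((((#V - t - 1).choose (b + c) : ℕ) : ℚ)))⁻¹ else 0))
            / (((#V - (a + b + c)).choose (4 - (a + b + c)) : ℕ) : ℚ))
          (fun a b c => (0 : ℚ) / (((#V - (a + b + c)).choose (4 - (a + b + c)) : ℕ) : ℚ))
          (fun a b c => (0 : ℚ) / (((#V - (a + b + c)).choose (4 - (a + b + c)) : ℕ) : ℚ))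
          (fun a b c => (0 : ℚ) / (((#V - (a + b + c)).choose (4 - (a + b + c)) : ℕ) : ℚ))
          (fun a b c => (0 : ℚ) / (((#V - (a + b + c)).choose (4 - (a + b + c)) : ℕ) : ℚ)) F G Q
        + ∑ P ∈ Q.powerset, ∑ P' ∈ Q.powerset,
          (ιq (smallXo F G) P * ιq (smallZo F G) P' * (if Disjoint P P' then 1 else 0) / (((#V - #(P ∪ P')).choose (4 - #(P ∪ P')) : ℕ) : ℚ)
           - ιq (smallN F G) P * ιq (smallY F G) P' * (if Disjoint P P' then 1 else 0) / (((#V - #(P ∪ P')).choose (4 - #(P ∪ P')) : ℕ) : ℚ))) :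
    0 ≤ (Rt 3 F G).coeff (ind V) := by
  refine coeff_ind_Rt_three_nonneg_of_window hF hG V hV ?_
  obtain ⟨hXo, hZo, hN, hY⟩ := card_le_two_of_mem_small F G
  rw [sum_sub_distrib, sum_pairsAt_eq_sum_powersetCard _ _ hXo hZo V hV, sum_pairsAt_eq_sum_powersetCard _ _ hN hY V hV,
    ← sum_sub_distrib, ← sum_add_distrib]
  refine sum_nonneg fun Q hQ => ?_
  have h := hloc Q hQ
  simp only [← sum_sub_distrib] at h ⊢
  exact h

end Summit.CriticalPhenomena.PercolationContinuityZ3.Theorems.SahiCTCForms
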